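import Summits.KontsevichZagierPeriods.KontsevichZagierPeriods.Theorems.HurwitzSectorComplement.Negative.Core
import Summits.KontsevichZagierPeriods.KontsevichZagierPeriods.Theorems.HurwitzMicroSectorsHurwitzSectorComplementSymmetricTowerSector
import Literature.NumberTheory.Transcendental.KZKernelConjectureForms

/-!
# `HurwitzSectorComplement` (stmt-KontsevichZagierPeriods-14341) — negative side, IV: the splice remainders ARE the summit

By-product of the siege on `stub_spliceRemainder` (line `chebyshev-level-deformation`, skeleton
`Cruxes/HurwitzSectorComplement/Lines/chebyshev_level_deformation.lean`). Both lines built for this crux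
end in a DECLARED "splice remainder" stub of the shape `Sector → NormalFormPrinciple`, where `Sector`
is Conjecture 1 of Kontsevich–Zagier RESTRICTED to an explicit family of representations:

* line `galois-parity-half`, S7 `stub_offSymmetricTower`: `Sector` = the rational symmetric Hurwitz
  tower — a TREE THEOREM (`symmetricTowerSector`, p92534);
* line `chebyshev-level-deformation`, S6 `stub_spliceRemainder`: `Sector` = the real-algebraic parity
  tower (`parityTowerSector`, the composition of that line's stubs S1–S5).

This file records, kernel-checked and with the two registered signatures VERBATIM, why neither stub can
be landed short of proving the summit `KontsevichZagierPeriods` (and why neither is vacuously true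
short of DISproving it):

* §1 (pure logic over `nfp_iff_statement : NormalFormPrinciple ↔ KontsevichZagierPeriods`): for
  every `P`, `(P → NormalFormPrinciple) ↔ (P → KontsevichZagierPeriods)` (`imp_nfp_iff`) and
  `¬ (P → NormalFormPrinciple) ↔ P ∧ ¬ KontsevichZagierPeriods` (`not_imp_nfp_iff`); if `P` holds,
  `(P → NormalFormPrinciple) ↔ KontsevichZagierPeriods` (`imp_nfp_iff_statement`); if the summit
  implies `P`, then `KontsevichZagierPeriods ↔ P ∧ (P → NormalFormPrinciple)`
  (`statement_iff_and_imp_nfp`).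
* §2 every sector is a consequence of the summit (`equivalent_of_statement`: drop `IsRational` by the
  tree theorem `KZ.exists_isRational_equivalent_holds`, packaged as
  `kzPeriodConjecture'_iff_isRational`), in particular the parity tower (`parityTower_of_statement`).
* §3 the two registered remainders: `offSymmetricTower_iff_statement` — S7 is the summit outright;
  `statement_iff_parityTower_and_spliceRemainder` — the picked line's headline TOGETHER WITH its S6 is
  exactly the summit (so once S1–S5 land, S6 is the summit: `imp_nfp_iff_statement`; and S6 fails iff
  the parity tower holds and the summit fails: `not_imp_nfp_iff`).

So a Lean proof of either stub is a Lean proof of Conjecture 1 for the H21 calculus from (a theorem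
weaker than) itself, i.e. a proof of the summit; nothing in the route's mechanism or in the landed
sector lemmas bears on it (`Negative/FiniteRungTable.lean`: no finite splice of rungs reaches it).

Sources: M. Kontsevich, D. Zagier, *Periods* (2001), §1.1 (remark after the Definition: algebraic
integrands give the same periods) and §1.2 Conjecture 1.
-/

noncomputable section

namespace Summit.KontsevichZagierPeriods.Theorems.HurwitzSectorComplement.Negative

open Set MeasureTheory
open scoped BigOperators
open Literature.NumberTheory.Transcendental
open Literature.NumberTheory.Transcendental.KZ
open Summit.KontsevichZagierPeriods.KontsevichZagierPeriods.Theses.HurwitzMicroSectors (NormalFormPrinciple)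
open Summit.KontsevichZagierPeriods.Theorems.HurwitzMicroSectorsHurwitzSectorComplement (symmetricTowerSector)

/-! ## §1 Remainders `P → NormalFormPrinciple`: pure logic over `nfp_iff_statement` -/

/-- For every antecedent `P`, the remainder `P → NormalFormPrinciple` is the implication
`P → KontsevichZagierPeriods` (the route's target restates the summit, `nfp_iff_statement`). [folklore] -/
theorem imp_nfp_iff (P : Prop) : (P → NormalFormPrinciple) ↔ (P → KontsevichZagierPeriods) :=
  imp_congr_right fun _ => nfp_iff_statement

/-- Once the antecedent `P` is a theorem, the remainder `P → NormalFormPrinciple` IS the summit. [folklore] -/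
theorem imp_nfp_iff_statement {P : Prop} (hP : P) : (P → NormalFormPrinciple) ↔ KontsevichZagierPeriods :=
  ⟨fun h => nfp_iff_statement.mp (h hP), fun h _ => nfp_iff_statement.mpr h⟩

/-- If the summit implies the antecedent `P` (every sector of Conjecture 1 is such a `P`, §2), then the
summit is EXACTLY `P` together with its remainder. [folklore] -/
theorem statement_iff_and_imp_nfp {P : Prop} (hP : KontsevichZagierPeriods → P) :
    KontsevichZagierPeriods ↔ (P ∧ (P → NormalFormPrinciple)) :=
  ⟨fun h => ⟨hP h, fun _ => nfp_iff_statement.mpr h⟩, fun h => nfp_iff_statement.mp (h.2 h.1)⟩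

/-- For every antecedent `P`, the remainder is false iff `P` holds and the summit fails: it is never
vacuously true short of a disproof of the summit. [folklore] -/
theorem not_imp_nfp_iff (P : Prop) :
    ¬ (P → NormalFormPrinciple) ↔ (P ∧ ¬ KontsevichZagierPeriods) := by
  rw [imp_nfp_iff, Classical.not_imp]

/-! ## §2 Every sector of Conjecture 1 is a consequence of the summit -/

/-- **The summit gives Conjecture 1 for ALL pairs of representations**, not only those of KZ's literal
(rational) shape: every representation is move-equivalent to a rational one
(`KZ.exists_isRational_equivalent_holds`, Kontsevich–Zagier §1.1, remark after the Definition), and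
moves preserve values. Hence Conjecture 1 restricted to ANY family is implied by the summit.
[cite: KontsevichZagier2001, §1.1 remark after the Definition] -/
theorem equivalent_of_statement (h : KontsevichZagierPeriods) {n m : ℕ} (r : IntegralRep n)
    (r' : IntegralRep m) (hv : r.value = r'.value) : Equivalent r r' :=
  (kzPeriodConjecture'_iff_isRational.mpr (KontsevichZagierPeriods_iff.mp h)) r r' hv

/-- **The parity-tower sector follows from the summit.** The antecedent of `stub_spliceRemainder`
(line `chebyshev-level-deformation`; = the statement of that line's headline `parityTowerSector`,
verbatim) is a consequence of `KontsevichZagierPeriods`. [cite: KontsevichZagier2001, §1.2 Conjecture 1] -/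
theorem parityTower_of_statement (h : KontsevichZagierPeriods) :
    ∀ (w N w' N' : ℕ), 2 ≤ w → 1 ≤ N → 2 ≤ w' → 1 ≤ N' →
      ∀ (r : KZ.IntegralRep w) (r' : KZ.IntegralRep w'),
      (∃ (Q R : Polynomial ℝ), (∀ i, IsAlgebraic ℚ (Q.coeff i)) ∧ (∀ i, IsAlgebraic ℚ (R.coeff i)) ∧
        R.natDegree < N ∧ (∀ i j : ℕ, i + j + 2 = N → R.coeff i = (-1 : ℝ) ^ w * R.coeff j) ∧
        (Odd w → R.coeff (N - 1) = 0) ∧ r.domain = {x | ∀ i, x i ∈ Set.Ioo (0:ℝ) 1} ∧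
        Set.EqOn r.integrand (fun x => Polynomial.eval (∏ i, x i) Q +
          Polynomial.eval (∏ i, x i) R / (1 - (∏ i, x i) ^ N)) r.domain) →
      (∃ (Q R : Polynomial ℝ), (∀ i, IsAlgebraic ℚ (Q.coeff i)) ∧ (∀ i, IsAlgebraic ℚ (R.coeff i)) ∧
        R.natDegree < N' ∧ (∀ i j : ℕ, i + j + 2 = N' → R.coeff i = (-1 : ℝ) ^ w' * R.coeff j) ∧
        (Odd w' → R.coeff (N' - 1) = 0) ∧ r'.domain = {x | ∀ i, x i ∈ Set.Ioo (0:ℝ) 1} ∧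
        Set.EqOn r'.integrand (fun x => Polynomial.eval (∏ i, x i) Q +
          Polynomial.eval (∏ i, x i) R / (1 - (∏ i, x i) ^ N')) r'.domain) →
      r.value = r'.value → KZ.Equivalent r r' :=
  fun _ _ _ _ _ _ _ _ r r' _ _ hv => equivalent_of_statement h r r' hv

/-! ## §3 The two registered splice remainders of the crux -/

/-- **S7 of line `galois-parity-half` IS the summit.** Its antecedent — Conjecture 1 on the rational
symmetric Hurwitz tower, written verbatim — is the tree theorem `symmetricTowerSector`, so the
registered stub `stub_offSymmetricTower` is equivalent to `KontsevichZagierPeriods` outright.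
[cite: KontsevichZagier2001, §1.2 Conjecture 1] -/
theorem offSymmetricTower_iff_statement :
    ((∀ (w N w' N' : ℕ), 2 ≤ w → 1 ≤ N → 2 ≤ w' → 1 ≤ N' → ∀ (r : KZ.IntegralRep w) (r' : KZ.IntegralRep w'), (∃ (Q R : Polynomial ℚ), R.natDegree < N ∧ (∀ i j : ℕ, i + j + 2 = N → R.coeff i = (-1 : ℚ) ^ w * R.coeff j) ∧ (Odd w → R.coeff (N - 1) = 0) ∧ r.domain = {x | ∀ i, x i ∈ Set.Ioo (0:ℝ) 1} ∧ Set.EqOn r.integrand (fun x => Polynomial.aeval (∏ i, x i) Q + Polynomial.aeval (∏ i, x i) R / (1 - (∏ i, x i) ^ N)) r.domain) → (∃ (Q R : Polynomial ℚ), R.natDegree < N' ∧ (∀ i j : ℕ, i + j + 2 = N' → R.coeff i = (-1 : ℚ) ^ w' * R.coeff j) ∧ (Odd w' → R.coeff (N' - 1) = 0) ∧ r'.domain = {x | ∀ i, x i ∈ Set.Ioo (0:ℝ) 1} ∧ Set.EqOn r'.integrand (fun x => Polynomial.aeval (∏ i, x i) Q + Polynomial.aeval (∏ i, x i) R / (1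 - (∏ i, x i) ^ N')) r'.domain) → r.value = r'.value → KZ.Equivalent r r') → NormalFormPrinciple) ↔
      KontsevichZagierPeriods :=
  imp_nfp_iff_statement symmetricTowerSector

/-- **The picked line plus its S6 is exactly the summit.** With `PTS` the registered antecedent of
`stub_spliceRemainder` (verbatim; = the statement of `parityTowerSector`):
`KontsevichZagierPeriods ↔ PTS ∧ (PTS → NormalFormPrinciple)`. So landing S1–S5 (`PTS`) and S6
together would be a proof of Conjecture 1 for the H21 calculus, and S6 is not vacuously true unless the
summit is false. [cite: KontsevichZagier2001, §1.2 Conjecture 1] -/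
theorem statement_iff_parityTower_and_spliceRemainder :
    KontsevichZagierPeriods ↔
      ((∀ (w N w' N' : ℕ), 2 ≤ w → 1 ≤ N → 2 ≤ w' → 1 ≤ N' →
        ∀ (r : KZ.IntegralRep w) (r' : KZ.IntegralRep w'),
        (∃ (Q R : Polynomial ℝ), (∀ i, IsAlgebraic ℚ (Q.coeff i)) ∧ (∀ i, IsAlgebraic ℚ (R.coeff i)) ∧
          R.natDegree < N ∧ (∀ i j : ℕ, i + j + 2 = N → R.coeff i = (-1 : ℝ) ^ w * R.coeff j) ∧
          (Odd w → R.coeff (N - 1) = 0) ∧ r.domain = {x | ∀ i, x i ∈ Set.Ioo (0:ℝ) 1} ∧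
          Set.EqOn r.integrand (fun x => Polynomial.eval (∏ i, x i) Q +
            Polynomial.eval (∏ i, x i) R / (1 - (∏ i, x i) ^ N)) r.domain) →
        (∃ (Q R : Polynomial ℝ), (∀ i, IsAlgebraic ℚ (Q.coeff i)) ∧ (∀ i, IsAlgebraic ℚ (R.coeff i)) ∧
          R.natDegree < N' ∧ (∀ i j : ℕ, i + j + 2 = N' → R.coeff i = (-1 : ℝ) ^ w' * R.coeff j) ∧
          (Odd w' → R.coeff (N' - 1) = 0) ∧ r'.domain = {x | ∀ i, x i ∈ Set.Ioo (0:ℝ) 1} ∧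
          Set.EqOn r'.integrand (fun x => Polynomial.eval (∏ i, x i) Q +
            Polynomial.eval (∏ i, x i) R / (1 - (∏ i, x i) ^ N')) r'.domain) →
        r.value = r'.value → KZ.Equivalent r r') ∧
      ((∀ (w N w' N' : ℕ), 2 ≤ w → 1 ≤ N → 2 ≤ w' → 1 ≤ N' →
        ∀ (r : KZ.IntegralRep w) (r' : KZ.IntegralRep w'),
        (∃ (Q R : Polynomial ℝ), (∀ i, IsAlgebraic ℚ (Q.coeff i)) ∧ (∀ i, IsAlgebraic ℚ (R.coeff i)) ∧
          R.natDegree < N ∧ (∀ i j : ℕ, i + j + 2 = N → R.coeff i = (-1 : ℝ) ^ w * R.coeff j) ∧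
          (Odd w → R.coeff (N - 1) = 0) ∧ r.domain = {x | ∀ i, x i ∈ Set.Ioo (0:ℝ) 1} ∧
          Set.EqOn r.integrand (fun x => Polynomial.eval (∏ i, x i) Q +
            Polynomial.eval (∏ i, x i) R / (1 - (∏ i, x i) ^ N)) r.domain) →
        (∃ (Q R : Polynomial ℝ), (∀ i, IsAlgebraic ℚ (Q.coeff i)) ∧ (∀ i, IsAlgebraic ℚ (R.coeff i)) ∧
          R.natDegree < N' ∧ (∀ i j : ℕ, i + j + 2 = N' → R.coeff i = (-1 : ℝ) ^ w' * R.coeff j) ∧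
          (Odd w' → R.coeff (N' - 1) = 0) ∧ r'.domain = {x | ∀ i, x i ∈ Set.Ioo (0:ℝ) 1} ∧
          Set.EqOn r'.integrand (fun x => Polynomial.eval (∏ i, x i) Q +
            Polynomial.eval (∏ i, x i) R / (1 - (∏ i, x i) ^ N')) r'.domain) →
        r.value = r'.value → KZ.Equivalent r r') → NormalFormPrinciple)) :=
  statement_iff_and_imp_nfp parityTower_of_statement

end Summit.KontsevichZagierPeriods.Theorems.HurwitzSectorComplement.Negative

end
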